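import Literature.AnabelianGeometry.EtaleTheta.SettingModelSlice2Defs
import HarnessLib

/-!
# (L3′) slice 2, file 2/13 — letters, `a`-powers `a^s`, `b`-lines `β_s^t`, `Ẑ`-multiplication and iterated `Ẑ`-powers in `F̂₂`

Part of the (L3′) slice-2 chain (abc-iut-L6-t19; FILING SHAPE derived from scratch v5 `Slice2TheoremR2ScratchV5.lean`
551b982286441a66 by the edits E1–E4/D1–D3/H1–H2 of FILING-PLAN-SLICE2.md 9643c7e42a42ad24 and the OPTION-L re-cut of §F v1.19gz (W):
one definitions file + twelve theorem files).  Classical profinite group theory about OUR semi-synthetic `F₂hatT`; the objects and laws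
are those of the one-sentence residual of record (cf. [EtTh] §1, §2 for the role they play there — nothing of [EtTh]/[IUTchII]/[IUTchIII]
in print is asserted; no side on [IUTchIII] Cor. 3.12; MORATORIUM (E): no application to `hext_at_iff_exists_f2hatAut_of_eq`).
-/

noncomputable section

open scoped Pointwise

namespace Literature.AnabelianGeometry.EtaleTheta.SettingModel.Slice2

open Literature.AnabelianGeometry.EtaleTheta.SettingModel
open Literature.AnabelianGeometry.EtaleTheta (ZHatLevel.level ZHatLevel.levelChar)
open Literature.AnabelianGeometry.SemiGraphs (GQp)
open Literature.AnabelianGeometry.AbsoluteAnabelian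
open Literature.AnabelianGeometry.AbsoluteAnabelian.AbsTopII
open _root_.Topology

/-! ## §1 Letters, `a`-powers, `b`-lines -/

/-- `a^{st} = a^s a^t`. [cite: MochizukiEtTh2009, §1 p.12] -/
theorem aPow_mul (s t : ZH) : aPow (s * t) = aPow s * aPow t := map_mul (powHat ea) s t

/-- `a^{s⁻¹} = (a^s)⁻¹`. [cite: MochizukiEtTh2009, §1 p.12] -/
theorem aPow_inv (s : ZH) : aPow s⁻¹ = (aPow s)⁻¹ := map_inv (powHat ea) s

/-- `a^1 = 1`. [cite: MochizukiEtTh2009, §1 p.12] -/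
@[simp] theorem aPow_one : aPow 1 = 1 := map_one (powHat ea)

/-- `a^{η 1} = a`. [cite: MochizukiEtTh2009, §1 p.12] -/
theorem aPow_zOne : aPow zOne = ea := by
  rw [aPow, zOne, ← iotaZ_one_eq, powHat_iotaZ_one]

/-- `a^{η k} = a^k` (`k ∈ ℤ`). [cite: MochizukiEtTh2009, §1 p.12] -/
theorem aPow_eta (k : ℤ) : aPow (ZHatLevel.eta k) = ea ^ k := by
  change powHat ea (iotaZ (Multiplicative.ofAdd k)) = ea ^ k
  rw [powHat_iotaZ, toAdd_ofAdd]

/-- `a^s` and `a^t` commute. [cite: MochizukiEtTh2009, §1 p.12] -/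
theorem aPow_comm (s t : ZH) : aPow s * aPow t = aPow t * aPow s := by
  rw [← aPow_mul, ZHatCompletion.mul_comm, aPow_mul]

/-- `b^s` and `b^t` commute (re-export of `commute_of_mem_bAxis`). [cite: MochizukiEtTh2009, §1 p.12] -/
theorem bPow_comm (s t : ZH) : bPow s * bPow t = bPow t * bPow s := by
  rw [← map_mul, ZHatCompletion.mul_comm, map_mul]

/-- **Conjugation commutes with `Ẑ`-powers**: `(g x g⁻¹)^t = g x^t g⁻¹` — a file-private copy of the landed
`SettingModel.powHat_conj` (its home is an (E)-class module that this chain does not import; R2′ of §F v1.19gz (W)(4)).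
[cite: MochizukiEtTh2009, §1 p.12] -/
private theorem powHat_conj (g x : F₂hatT) (t : ZH) : powHat (g * x * g⁻¹) t = g * powHat x t * g⁻¹ := by
  let C : F₂hatT →ₜ* F₂hatT :=
    { toMonoidHom := (MulAut.conj g).toMonoidHom
      continuous_toFun := (continuous_const.mul continuous_id).mul continuous_const }
  have hC : ∀ y, C y = g * y * g⁻¹ := fun _ => rfl
  have h := map_powHat C x t
  rw [hC, hC] at h
  exact h.symm

/-- `β_s^t = (β_s^1)`-power: `β_s^t = powHat (a^s b a^{-s}) t`. [cite: MochizukiEtTh2009, §1 p.12] -/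
theorem betaPow_eq_powHat (s t : ZH) : betaPow s t = powHat (aPow s * eb * (aPow s)⁻¹) t := by
  rw [powHat_conj, ← bPow_eq_powHat, betaPow]

/-- `β_s^{t t'} = β_s^t β_s^{t'}`. [cite: MochizukiEtTh2009, §1 p.12] -/
theorem betaPow_mul (s t t' : ZH) : betaPow s (t * t') = betaPow s t * betaPow s t' := by
  simp only [betaPow_eq_powHat, map_mul]

/-- `β_s^{t⁻¹} = (β_s^t)⁻¹`. [cite: MochizukiEtTh2009, §1 p.12] -/
theorem betaPow_inv (s t : ZH) : betaPow s t⁻¹ = (betaPow s t)⁻¹ := by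
  simp only [betaPow_eq_powHat, map_inv]

/-- `β_s^1 = 1`. [cite: MochizukiEtTh2009, §1 p.12] -/
@[simp] theorem betaPow_one (s : ZH) : betaPow s 1 = 1 := by
  simp only [betaPow_eq_powHat, map_one]

/-- `β_1^t... at s = 1 ∈ Ẑ` (i.e. `a^0`): `β_{0}^t = b^t`. [cite: MochizukiEtTh2009, §1 p.12] -/
theorem betaPow_zero (t : ZH) : betaPow 1 t = bPow t := by
  rw [betaPow, aPow_one, one_mul, inv_one, mul_one]

/-- `(β_s^t)^{t'} = β_s^{?}`: powers of `β_s^t` stay on the line `a^s B`: `powHat (β_s^t) t' = a^s (b^t)^{t'} a^{-s}`.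
[cite: MochizukiEtTh2009, §1 p.12] -/
theorem powHat_betaPow (s t t' : ZH) : powHat (betaPow s t) t' = aPow s * powHat (bPow t) t' * (aPow s)⁻¹ := by
  rw [betaPow, powHat_conj]

/-- Powers of `b^t` lie on `B` (they commute with `b`; `C_F(b) = B`). [cite: MochizukiEtTh2009, §1 p.12] -/
theorem powHat_bPow_mem_bAxis (t t' : ZH) : powHat (bPow t) t' ∈ bAxis := by
  apply DehnTwist.mem_bAxis_of_commute_eta_one
  have hb : eb * bPow t * eb⁻¹ = bPow t := by
    rw [DehnTwist.commute_of_mem_bAxis eta_of_one_mem_bAxis (bPow_mem_bAxis t), mul_inv_cancel_right]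
  have h := powHat_conj eb (bPow t) t'
  rw [hb] at h
  -- `h : powHat (b^t) t' = b * powHat (b^t) t' * b⁻¹`
  change powHat (bPow t) t' * eb = eb * powHat (bPow t) t'
  conv_lhs => rw [h]
  rw [inv_mul_cancel_right]

/-- `θ_φ(β_s^t) = β_s^{φ t}` (early copy). [cite: MochizukiEtTh2009, §1 p.12] -/
theorem twist_betaPow' (φ : MulAut ZH) (s t : ZH) : twist φ (betaPow s t) = betaPow s (φ t) := by
  rw [betaPow, map_mul, map_mul, map_inv, aPow, twist_powHat, twist_eta_of_zero, twist_bPow, betaPow, aPow]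

/-! ### The `Ẑ`-module structure of `Ẑ` (ring multiplication via `ZHatLevel.powEnd`): `zmul u t = "u·t"` -/

/-- Levels: `(u·t)_n = u_n t_n`. [cite: RibesZalesskii2010, Thm 2.7.1] -/
theorem toAdd_level_zmul (n : ℕ+) (u t : ZH) :
    Multiplicative.toAdd (ZHatLevel.level n (zmul u t)) =
      Multiplicative.toAdd (ZHatLevel.level n u) * Multiplicative.toAdd (ZHatLevel.level n t) :=
  ZHatLevel.toAdd_level_powEnd _ n t

/-- `u·t = t·u`. [cite: RibesZalesskii2010, Thm 2.7.1] -/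
theorem zmul_comm (u t : ZH) : zmul u t = zmul t u :=
  ZHatLevel.ext_of_level fun n => Multiplicative.toAdd.injective (by rw [toAdd_level_zmul, toAdd_level_zmul, mul_comm])

/-- `u·1 = u`. [cite: RibesZalesskii2010, Thm 2.7.1] -/
theorem zmul_zOne (u : ZH) : zmul u zOne = u :=
  ZHatLevel.ext_of_level fun n => Multiplicative.toAdd.injective (by
    rw [toAdd_level_zmul, zOne, ZHatLevel.level_eta, toAdd_ofAdd, Int.cast_one, mul_one])

/-- `1·t = t`. [cite: RibesZalesskii2010, Thm 2.7.1] -/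
theorem zOne_zmul (t : ZH) : zmul zOne t = t := by rw [zmul_comm, zmul_zOne]

/-- `(u·v)·t = u·(v·t)`. [cite: RibesZalesskii2010, Thm 2.7.1] -/
theorem zmul_assoc (u v t : ZH) : zmul (zmul u v) t = zmul u (zmul v t) :=
  ZHatLevel.ext_of_level fun n => Multiplicative.toAdd.injective (by simp only [toAdd_level_zmul, mul_assoc])

/-- `(u u')·t = (u·t)(u'·t)` (distributivity in the second spelling). [cite: RibesZalesskii2010, Thm 2.7.1] -/
theorem mul_zmul (u u' t : ZH) : zmul (u * u') t = zmul u t * zmul u' t :=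
  ZHatLevel.ext_of_level fun n => Multiplicative.toAdd.injective (by
    simp only [toAdd_level_zmul, map_mul, toAdd_mul, add_mul])

/-- `(η k)·t = t^k` (`k ∈ ℤ`). [cite: RibesZalesskii2010, Thm 2.7.1] -/
theorem zmul_eta (k : ℤ) (t : ZH) : zmul (ZHatLevel.eta k) t = t ^ k :=
  ZHatLevel.ext_of_level fun n => Multiplicative.toAdd.injective (by
    rw [toAdd_level_zmul, ZHatLevel.level_eta, toAdd_ofAdd, map_zpow, toAdd_zpow, zsmul_eq_mul])

/-- `u·(η k) = u^k`. [cite: RibesZalesskii2010, Thm 2.7.1] -/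
theorem zmul_eta_right (u : ZH) (k : ℤ) : zmul u (ZHatLevel.eta k) = u ^ k := by rw [zmul_comm, zmul_eta]

/-- **An automorphism of `Ẑ` is multiplication by the unit `φ(1)`**: `φ t = φ(1)·t`. [cite: RibesZalesskii2010, Thm 2.7.1] -/
theorem aut_apply_eq_zmul (φ : MulAut ZH) (t : ZH) : φ t = zmul (φ zOne) t :=
  ZHatLevel.ext_of_level fun n => Multiplicative.toAdd.injective (by
    rw [ZHatLevel.toAdd_level_aut, toAdd_level_zmul, ZHatLevel.levelChar_apply])

/-- `φ (u·t) = u·(φ t)`. [cite: RibesZalesskii2010, Thm 2.7.1] -/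
theorem aut_zmul (φ : MulAut ZH) (u t : ZH) : φ (zmul u t) = zmul u (φ t) := by
  rw [aut_apply_eq_zmul, aut_apply_eq_zmul φ t, ← zmul_assoc, ← zmul_assoc, zmul_comm (φ zOne)]

/-- **Iterated `Ẑ`-powers**: `(x^u)^t = x^{u·t}`. [cite: MochizukiEtTh2009, §1 p.12] -/
theorem powHat_powHat (x : F₂hatT) (u t : ZH) : powHat (powHat x u) t = powHat x (zmul u t) := by
  have key := powHat_unique (powHat x u) ((powHat x).comp (zmulC u)) (by
    change powHat x (zmul u (iotaZ (Multiplicative.ofAdd 1))) = powHat x u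
    rw [iotaZ_one_eq, ← zOne, zmul_zOne])
  exact (DFunLike.congr_fun key t).symm

/-- `b^{u·t} = (b^u)^t`. [cite: MochizukiEtTh2009, §1 p.12] -/
theorem bPow_zmul (u t : ZH) : bPow (zmul u t) = powHat (bPow u) t := by
  rw [bPow_eq_powHat, powHat_powHat]

/-- `b^{φ t} = (b^t)^{φ 1}`. [cite: MochizukiEtTh2009, §1 p.12] -/
theorem bPow_aut (φ : MulAut ZH) (t : ZH) : bPow (φ t) = powHat (bPow t) (φ zOne) := by
  rw [aut_apply_eq_zmul, zmul_comm, bPow_zmul]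

/-- `β_s^{u·t} = (β_s^u)^t`. [cite: MochizukiEtTh2009, §1 p.12] -/
theorem betaPow_zmul (s u t : ZH) : betaPow s (zmul u t) = powHat (betaPow s u) t := by
  rw [betaPow, bPow_zmul, ← powHat_conj, betaPow]

/-- **`θ_φ(β_s^t) = (β_s^t)^{φ 1}`** — the twist acts on a `b`-line element as the Adams operation by the unit
`φ(1)`. [cite: MochizukiEtTh2009, §1 p.12] -/
theorem twist_betaPow_eq_powHat (φ : MulAut ZH) (s t : ZH) :
    twist φ (betaPow s t) = powHat (betaPow s t) (φ zOne) := by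
  rw [twist_betaPow', aut_apply_eq_zmul, zmul_comm, betaPow_zmul]

/-! ### The operators on the letters: twist `θ_φ`, shear `s_k`, inner `Inn(b^t)`, inversion `ι = σ̂` -/

/-- `θ_φ(a^s) = a^s`. [cite: MochizukiEtTh2009, §1 p.12] -/
theorem twist_aPow (φ : MulAut ZH) (s : ZH) : twist φ (aPow s) = aPow s := by
  rw [aPow, twist_powHat, twist_eta_of_zero]

/-- `θ_φ(β_s^t) = β_s^{φ t}`. [cite: MochizukiEtTh2009, §1 p.12] -/
theorem twist_betaPow (φ : MulAut ZH) (s t : ZH) : twist φ (betaPow s t) = betaPow s (φ t) := by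
  rw [betaPow, map_mul, map_mul, map_inv, twist_aPow, twist_bPow, betaPow]

/-- `Inn(b^u)(β_s^t) = b^u β_s^t b^{-u}` (definition). [cite: MochizukiEtTh2009, §1 p.12] -/
theorem innB_apply' (u : ZH) (x : F₂hatT) : innB u x = bPow u * x * (bPow u)⁻¹ := innB_apply u x

/-- `powHat x⁻¹ t = powHat x t⁻¹`. [cite: MochizukiEtTh2009, §1 p.12] -/
theorem powHat_inv_left (x : F₂hatT) (t : ZH) : powHat x⁻¹ t = powHat x t⁻¹ := by
  have key : (powHat x).comp zhInv = powHat x⁻¹ := by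
    refine powHat_unique _ _ ?_
    change powHat x (iotaZ (Multiplicative.ofAdd 1))⁻¹ = x⁻¹
    rw [map_inv, powHat_iotaZ_one]
  exact (DFunLike.congr_fun key t).symm

/-- `σ̂(a^s) = a^{s⁻¹}`. [cite: MochizukiEtTh2009, §2 p.36] -/
theorem sigmaHat_aPow (s : ZH) : sigmaHat (aPow s) = aPow s⁻¹ := by
  rw [aPow, aPow, map_powHat sigmaHat ea s, sigmaHat_eta, invGenHom_of, map_inv, powHat_inv_left]

/-- `σ̂(β_s^t) = β_{s⁻¹}^{t⁻¹}`. [cite: MochizukiEtTh2009, §2 p.36] -/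
theorem sigmaHat_betaPow (s t : ZH) : sigmaHat (betaPow s t) = betaPow s⁻¹ t⁻¹ := by
  rw [betaPow, map_mul, map_mul, map_inv, sigmaHat_aPow, sigmaHat_bPow, ← map_inv bPow, betaPow]

/-! ### Degrees: `ê(a^s) = s`, `ê(β_s^t) = 1` -/

/-- `ê(a^s) = s`. [cite: MochizukiEtTh2009, §1 p.12] -/
theorem eHat_aPow (s : ZH) : eHat (aPow s) = s := by
  have h := ZHatCompletion.monoidHom_ext_of_continuous (f₁ := eHat.toMonoidHom.comp (powHat ea).toMonoidHom)
    (f₂ := MonoidHom.id ZH) (eHat.continuous.comp (powHat ea).continuous) continuous_id (by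
      change eHat (powHat ea (iotaZ (Multiplicative.ofAdd 1))) = iotaZ (Multiplicative.ofAdd 1)
      rw [powHat_iotaZ_one, eHat_eta, expA_of_zero])
  exact DFunLike.congr_fun h s

/-- `ê(β_s^t) = 1`. [cite: MochizukiEtTh2009, §1 p.12] -/
theorem eHat_betaPow (s t : ZH) : eHat (betaPow s t) = 1 := by
  rw [betaPow, map_mul, map_mul, map_inv, eHat_bPow, mul_one, mul_inv_cancel]

/-! ### Heisenberg levels: `ĥ_N(a^s) = (s̄,0,0)`, `ĥ_N(β_s^t) = (0, t̄, s̄ t̄)` -/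

/-- The level of `a^s`: `ĥ_N(a^s) = (s mod N, 0, 0)`. [cite: MochizukiEtTh2009, §1 p.12] -/
theorem hHat_aPow (N : ℕ+) (s : ZH) :
    hHat N (aPow s) = ⟨Multiplicative.toAdd (ZHatLevel.level N s), 0, 0⟩ := by
  let X : Multiplicative (ZMod N) →* Heis (ZMod N) :=
    { toFun := fun c => ⟨Multiplicative.toAdd c, 0, 0⟩
      map_one' := by ext <;> simp
      map_mul' := fun c c' => by ext <;> simp }
  have h := ZHatCompletion.monoidHom_ext_of_continuous
    (f₁ := (hHat N).toMonoidHom.comp (powHat ea).toMonoidHom) (f₂ := X.comp (ZHatLevel.level N))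
    ((hHat N).continuous.comp (powHat ea).continuous)
    ((continuous_of_discreteTopology (f := X)).comp (continuous_zhatLevel N)) (by
      change hHat N (powHat ea (iotaZ (Multiplicative.ofAdd 1))) = X (ZHatLevel.level N (iotaZ (Multiplicative.ofAdd 1)))
      rw [powHat_iotaZ_one, hHat_eta, heisHom_of_zero, iotaZ_one_eq, ZHatLevel.level_eta, Int.cast_one]
      ext <;> simp [X])
  exact DFunLike.congr_fun h s

/-- The level of a `b`-line element: `ĥ_N(β_s^t) = (0, t̄, s̄·t̄)`. [cite: MochizukiEtTh2009, §1 p.12] -/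
theorem hHat_betaPow (N : ℕ+) (s t : ZH) :
    hHat N (betaPow s t) = ⟨0, Multiplicative.toAdd (ZHatLevel.level N t),
      Multiplicative.toAdd (ZHatLevel.level N s) * Multiplicative.toAdd (ZHatLevel.level N t)⟩ := by
  rw [betaPow, map_mul, map_mul, map_inv, hHat_aPow, hHat_bPow]
  ext <;> simp

end Literature.AnabelianGeometry.EtaleTheta.SettingModel.Slice2

end
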